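import Mathlib
import Summits.NavierStokesRegularity.NavierStokesRegularity.Theses.L3TimeExponentPincer
import HarnessLib.Audit
import HarnessLib

/-!
# Route `L3TimeExponentPincer` — the ASSEMBLY item (stmt-NavierStokesRegularity-19502): PROVED (pure logic)

`Assembly : L3CascadeJaw → SupercriticalSerrinL3 → NoBlowupToClay → NavierStokesRegularity` is the route's deciding
theorem `…Theses.L3TimeExponentPincer.closes` read as an implication: take the exponent `q ∈ (4,5)` of
`SupercriticalSerrinL3`; `L3CascadeJaw` at that `q` supplies the window-integrability hypothesis for every frame
solution; `SupercriticalSerrinL3` returns smooth extension past `T`; `NoBlowupToClay` turns "no blow-up in the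
Leray–Hopf frame" into Clay (A).  Bookkeeping only: the open content of the route is in the cruxes
(`EffSatBlowup` 19139 → `L3CascadeJaw` 19499 attacked; `SupercriticalSerrinL3` 19500 residual).

WHAT THIS IS NOT: not a claim about Navier–Stokes regularity — an implication whose antecedents are open conjectures.
Cell ns-regularity-ideate, seat p4.
-/

namespace Summit.NavierStokesRegularity.NavierStokesRegularity.Theorems

open Summit.NavierStokesRegularity.NavierStokesRegularity.Theses.L3TimeExponentPincer

/-- **Assembly of route `L3TimeExponentPincer`** (item `stmt-NavierStokesRegularity-19502`), by the route's deciding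
theorem `closes`: the two cruxes and the (proved-elsewhere) local-theory support imply the summit statement. -/
theorem l3TimeExponentPincer_assembly_proof :
    Summit.NavierStokesRegularity.NavierStokesRegularity.Theses.L3TimeExponentPincer.Assembly :=
  fun h₁ h₂ h₃ => closes h₁ h₂ h₃

end Summit.NavierStokesRegularity.NavierStokesRegularity.Theorems
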